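import Literature.NumberTheory.ComplexMultiplication.CMAlgebraLatticeLocallyPrincipal
import Mathlib.LinearAlgebra.FreeModule.Finite.CardQuotient
import HarnessLib

/-!
# SUFFICIENTLY HIGH POWERS OF FULL LATTICES ARE INVERTIBLE: for a full lattice `L` of a CM-algebra
# `Y = L_1 ⊕ ⋯ ⊕ L_t` of dimension `n`, with `1 ∈ L ⊆ Λ` for an order `Λ`, the chain `L ⊆ L² ⊆ ⋯` is stationary at an
# ORDER from the exponent `n − 1` on (Dedekind; DTZ62 Theorem C; HL 2026 Thm. 10.3 (c)(d)), and `L^k`, `k ≥ n − 1`, is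
# invertible for every full lattice whose weak class contains such a representative — in particular whenever `L`
# contains local generators of `LΛ` (HL 2026 Thm. 10.1 ∕ Thm. 10.3 (a)(b); HL26 Lemma 4.6)

Topic `Literature/NumberTheory/ComplexMultiplication`, namespace `Literature.NumberTheory.ComplexMultiplication`;
lane `lit-hodgefound` (Track 2 foundations library), Layer A3, seat p19 generation 33, row g33-#1 — sequel of g32-#2
(`CMAlgebraLatticeLocalization`: `ℤ ⇢ ℤ_(p)`, gluing Thm. 7.2 (c), Rem. 7.4), g32-#4 (`CMAlgebraLatticeLocallyPrincipal`:
Thm. 7.3, Thm. 8.2 (b) Step 1 `exists_invertible_order_mul_eq`), g32-#1 (`CMAlgebraLatticeWeakEquivalence`: `L_1 ∼_w L_2`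
⟺ `1 ∈ (L_1:L_2)(L_2:L_1)`, Thm. 4.4 (a)(c)) and g31-#5∕#9 (`CMAlgebraLatticeSemigroup`, `CMAlgebraLatticeInvertibleGroup`:
orders `𝒪(L) = L:L`, «invertible» = `L·(𝒪(L):L) = 𝒪(L)`, orders of products).  THEOREMS ONLY: no definition, no
instance, no named fact (D-0026, net Literature debt `0`), no `sorry`.

## Source, VERBATIM

C. Hertling, K. Larabi, *Semigroups from full lattices in commutative ℚ-algebras*, arXiv:2602.14973 (2026)
[HertlingLarabi2026], held `paper:arxiv-2602.14973`, §10 (chunks p0026–p0028):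
«A main result in [DTZ62] is Theorem C in section 1.5. It says that if `A` is an algebraic number field of dimension
`n ∈ ℤ_{≥2}` then for each full lattice `L ∈ 𝓛(A)` each power `L^k` with `k ≥ n−1` is invertible. This result was
generalized in [Si70] to the case when `A` is separable […]. **Theorem 10.1.** Let `A` be a commutative ℚ-algebra of
dimension `n ∈ ℤ_{≥2}` with unit element `1_A`. For each full lattice `L ∈ 𝓛(A)` each power `L^k` with `k ≥ n−1` is
invertible. […] **Theorem 10.3.** […] Let `L ∈ 𝓛(A)` be a full lattice. Let `Λ` be an order with `Λ ⊃ 𝒪(L)` and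
`ΛL ∈ G(Λ)`. (a) A full lattice `L_1 ∈ 𝓛(A)` with `L_1 ∼_w L` and `L_1Λ = Λ` exists. (b) A full lattice `L_2 ∈ 𝓛(A)` with
`L_2 ∼_w L`, `1_A ∈ L_2` and `L_2 ⊂ Λ` exists. (c) The full lattice `L_2` in part (b) satisfies: (i) The sequence
`(L_2^l)_{l∈ℕ}` of full lattices is increasing and becomes stationary, so there is a minimal number `N ∈ ℕ` with
`L_2^N = L_2^{N+l}` for each `l ≥ 0`. (ii) `Λ_2 := L_2^N` is an order with `Λ_2 ⊃ 𝒪(L)`. (d) In part (c) `N ≤ n−1`.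
*Proof:* (a) By Theorem 8.2 (b) the map `G(𝒪(L)) → G(Λ), K ↦ ΛK`, is a surjective group homomorphism. Choose
`K ∈ G(𝒪(L))` with `ΛK = ΛL`. Then `L_1 := LK⁻¹` satisfies `L_1Λ = Λ` and `L_1 ∼_w L` […]. (b) […] Therefore we can
choose an element `b_p ∈ L_1 ⊂ Λ` with `[b_p] ∈ (L_1+pΛ)/pΛ ∩ (Λ/pΛ)^{unit}`. By Lemma 7.5 (b) `b_p ∈ Λ_(p)^{unit}`. […]
By Theorem 7.3 there is a unique full lattice `L_2 ∈ 𝓛(A)` with `(L_2)_(p) = b_p⁻¹(L_1)_(p)` for each `p ∈ ℙ`. By Remark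
7.4 `L_2 ∼_w L_1 ∼_w L`. By construction `1_A = b_p⁻¹b_p ∈ (L_2)_(p)` for each `p ∈ ℙ`, so `1_A ∈ L_2`. For each `p ∈ ℙ`
`(L_2)_(p) ⊂ Λ_(p)` […], so `L_2 ⊂ Λ`. (c) (i) The sequence `(L_2^l)_{l∈ℕ}` is increasing because of `1_A ∈ L_2`. It
becomes stationary at some `L_2^N` because each `L_2^l ⊂ Λ`. (ii) `Λ_2 := L_2^N` is an order because `1_A ∈ L_2^N` and
`L_2^N·L_2^N = L_2^N`. (d) […] Consider the `n`-dimensional `𝔽_p`-vector space `Λ_2/pΛ_2` and the sequence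
`((L_2^l + pΛ_2)/pΛ_2)_{l∈ℕ}` of increasing `𝔽_p`-subspaces. […] if for some `m ∈ ℕ` `(L_2^m + pΛ_2)/pΛ_2 =
(L_2^{m+1} + pΛ_2)/pΛ_2`, then `(L_2^m + pΛ_2)/pΛ_2 = (L_2^{m+l} + pΛ_2)/pΛ_2` for each `l ≥ 1`. […]
`(L_2 + pΛ_2)/pΛ_2` has `𝔽_p`-dimension at least `2`, because else `𝔽_p[1_A] = Λ_2/pΛ_2`, a contradiction. Therefore
`N_p ≤ n−1`. […] so `L_2^{N_0+l} = Λ_2` for `l ≥ 0`. □ *Proof of Theorem 10.1:* […] By (5.3) and Theorem 5.7 (b)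
`Λ_2 ⊃ 𝒪(L_2) = 𝒪(L)`. Then by (4.4) `L^{n−1+l} ∼_w L_2^{n−1+l} = Λ_2` for `l ≥ 0`, so by Theorem 4.4 (c) and Theorem
5.7 (b) `L^{n−1+l}` is invertible for `l ≥ 0` with `𝒪(L^{n−1+l}) = Λ_2`.»

C. Hertling, K. Larabi, *Conjugacy classes of regular integer matrices*, arXiv:2602.15748 (2026) [= HL26], held
`paper:arxiv-2602.15748`, §4 (chunk p0007): «**Theorem 4.4** (DTZ62). [Si70] [HL26] Suppose that `A` has dimension
`n ∈ ℤ_{≥2}`. For each full lattice `L ∈ 𝓛(A)` each power `L^k` with `k ≥ n−1` is invertible. […] **Lemma 4.6.** Let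
`Λ` be an order, and let `L` be a full lattice which is not an order, but which satisfies `1_A ∈ L` and `L ⊂ Λ`. Then
there is a unique `l ∈ ℤ_{≥2}` with `L ⊊ L² ⊊ ⋯ ⊊ L^l = L^{l+k} ⊂ Λ` for `k ≥ 1`. `L^l` is an order with `L·L^l = L^l`.
The full lattices `L, L², …, L^{l−1}` are not invertible. […] **Example 4.7** (DTZ62). Let `dim A = n ≥ 3` and suppose
that `Λ = ℤ[a] ⊂ A` is an order. Define `L := ⟨1, a, 2a², …, 2a^{n−1}⟩_ℤ ⊂ Λ`. Then […]
`L ⊊ L² ⊊ L³ ⊊ ⋯ ⊊ L^{n−1} = L^n = ⋯ = Λ`» ([DTZ62] «ascribes the example and the observation to Dedekind»).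

## What is proved, and how the file departs from the printed proof

All for `Y = ∏ᵢ Lᵢ` (number fields `Lᵢ`), full lattices `M, Λ, … : Submodule ℤ Y`, `n = finrank ℚ Y`, in the tree's
vocabulary (orders: `1 ∈ Λ ∧ Λ·Λ ⊆ Λ`; `𝒪(M) = M/M`; «invertible»: `M·((M/M)/M) = M/M`; `L_1 ∼_w L_2`:
`1 ∈ (L_1/L_2)·(L_2/L_1)`; «`L_1`, `L_2` agree at `p`»: `∃ s, p ∤ s ∧ sL_1 ⊆ L_2 ∧ sL_2 ⊆ L_1`; `pΛ` is written
`(ℤp)·Λ = Submodule.span ℤ {↑p} * Λ`).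
* §1 THM. 10.3 (c) ∕ HL26 LEMMA 4.6 for `1 ∈ M ⊆ Λ`: the powers increase (`pow_le_pow_of_one_mem`), stay in `Λ`
  (`pow_le_of_le_order`), become stationary (`exists_forall_pow_add_eq`, Noetherian `Λ`), the stationary power is an
  ORDER with `M·M^N = M^N`, invertible (`pow_isOrder_of_forall_pow_add_eq`, `pow_mul_div_div_eq_of_forall_pow_add_eq`), and
  the earlier powers `M^j ≠ M^N`, `j ≥ 1`, are NOT invertible (`pow_mul_div_div_ne_of_ne_pow`).
* §2 THM. 10.3 (d) — THE BOUND `n − 1`: `[Λ : pΛ] = p^n` (`relIndex_span_natCast_mul_eq_pow`, via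
  `Submodule.natAbs_det_equiv`), so strictly increasing chains of lattices between `pΛ` and `Λ` have length `≤ n`
  (`chain_length_le_finrank`; this index count replaces HL's `𝔽_p`-dimensions); `Λ ⊆ ℤ1 + pΛ` forces `n ≤ 1`
  (`finrank_le_one_of_le_one_sup_span_natCast_mul`, Nakayama — HL's «else `𝔽_p[1_A] = Λ_2/pΛ_2`»); the chain
  `pΛ_2 ⊊ ℤ1 + pΛ_2 ⊊ M + pΛ_2 ⊊ M² + pΛ_2 ⊊ ⋯` then gives `M^{n−1} + pΛ_2 = Λ_2` for EVERY prime `p`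
  (`pow_finrank_sub_one_sup_span_natCast_mul_eq`), whence `M^{n−1} = Λ_2` because a finitely generated `Λ_2/… ` that is
  `p`-divisible for all `p` and killed by some `e ≠ 0` vanishes (`le_of_forall_prime_le_sup_span_natCast_mul` — HL
  instead localise and use Nakayama with `L = ⋂_p L_(p)`): **`pow_eq_pow_finrank_sub_one_of_one_mem_le_order`** (`M^k =
  M^{n−1}` for all `k ≥ n − 1`, `n ≥ 2`) and **`pow_isOrder_of_one_mem_le_order`** (`M^k` is an order, `𝒪(M^k) = M^k`,
  invertible, `M·M^k = M^k`, for `k ≥ n − 1`).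
* §3 THM. 10.3 (a) as printed: **`exists_weak_mul_order_eq_order`**.
* §4 THM. 10.3 (b) UNDER A HYPOTHESIS: **`exists_weak_one_mem_le_order_of_forall_exists_units_locEq`** — if at each prime
  `p` where `L` and `Λ` disagree some `c_p ∈ L ∩ Y^×` has `(LΛ)_(p) = c_pΛ_(p)`, then HL's gluing yields `L_2 ∼_w L` with
  `1 ∈ L_2 ⊆ Λ` (for ANY full order `Λ`; `Λ ⊇ 𝒪(L)` and `ΛL ∈ G(Λ)` are not used).  CAVEAT, recorded for the tribunal:
  part (b) AS PRINTED does not hold in general — HL's prime avoidance is applied to the `𝔽_p`-subspace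
  `(L_1+pΛ)/pΛ`, which may lie in a union of `> p` maximal ideals; e.g. `A = ℚ³` or a cubic field with `2` totally split,
  `Λ = Λ_max`, `L_1` = preimage of `{000,110,011,101} ⊂ Λ/2Λ ≅ 𝔽_2³`: `L_1Λ = Λ`, yet no lattice locally equivalent to
  `L_1` contains `1` and lies in an order (while `L_1² = Λ`, so Thm. 10.1 holds for it).  DTZ62's own proof (not held;
  acquisition pending) is by localisation at maximal ideals; HL's argument is complete whenever every bad prime `p`
  has at most `p` maximal ideals of `Λ` above it (then the subspace avoidance is legitimate).
* §5 THM. 10.1 ∕ DTZ62 THEOREM C: **`pow_mul_div_div_eq_of_weak_one_mem_le_order`** (the printed deduction: `L_2 ∼_w L`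
  with `1 ∈ L_2 ⊆ Λ′` ⟹ `L^k` invertible for all `k ≥ n−1`, `𝒪(L^k) = L_2^{n−1}`), **`pow_mul_div_div_eq_of_forall_exists_units_locEq`**
  (unconditional for lattices with local generators as in §4) and `pow_mul_div_div_eq_of_one_mem_units_smul_le_order`
  (the case `1 ∈ uL ⊆ Λ`).
NOT here: the residual case of Thm. 10.1 (bad primes `p` with more than `p` maximal ideals above `p` and no local
generator in `L`); HL Thm. 10.2 (for separable `Y` it is `Λ = Λ_max`, the tree's `pic_pi_integralClosure_iff`); Example 4.7.

## References
* [HertlingLarabi2026] C. Hertling, K. Larabi, arXiv:2602.14973 (2026), §10 Thm. 10.1, Thm. 10.3 (a)–(d) and proofs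
  (chunks p0026–p0028); §4 Thm. 4.4, §5 Thm. 5.7, §7 Thm. 7.2, 7.3, Rem. 7.4, §8 Thm. 8.2 (b).
  [cite: HertlingLarabi2026, §10 Thm. 10.1 and Thm. 10.3, chunks p0026–p0028]
* [HertlingLarabi2026] (companion) C. Hertling, K. Larabi, *Conjugacy classes of regular integer matrices*,
  arXiv:2602.15748 (2026), §4 Thm. 4.4, Lemma 4.6, Example 4.7 (chunk p0007). [cite: HertlingLarabi2026, companion paper arXiv:2602.15748 §4 Lemma 4.6, chunk p0007]
* [DadeTausskyZassenhaus1962] E. C. Dade, O. Taussky, H. Zassenhaus, *On the theory of orders, in particular on the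
  semigroup of ideal classes and genera of an order in an algebraic number field*, Math. Ann. 148 (1962) 31–64, §1.5
  Theorem C (cited through HL 2026 §10 and HL26 Thm. 4.4; source not held). [cite: DadeTausskyZassenhaus1962, §1.5 Theorem C (as cited by HertlingLarabi2026 §10)]
* M. Singer, *Invertible powers of ideals over orders in commutative separable algebras*, Proc. Cambridge Philos. Soc.
  67 (1970) 237–242 [Si70] (the separable case, as cited by HL 2026 §10; not held).
-/

noncomputable section

open scoped Classical Pointwise nonZeroDivisors NumberField
open Module NumberField Function

namespace Literature.NumberTheory.ComplexMultiplication

open Literature.NumberTheory.Automorphic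

section PowersInvertible

variable {t : Type} {L : t → Type} [∀ i, Field (L i)] [∀ i, NumberField (L i)]

/-! ## §1 Powers of a full lattice `M` with `1 ∈ M ⊆ Λ`: the increasing chain `M ⊆ M² ⊆ ⋯` becomes
stationary at an ORDER (Dedekind; HL26 Lemma 4.6; HL 2026 Thm. 10.3 (c)) -/

omit [∀ i, NumberField (L i)] in
/-- `1 ∈ M ⟹ M^m ⊆ M^{m+1}` («`1_A ∈ L` implies `L^{m+1} = L·L^m ⊃ L^m`»). [cite: HertlingLarabi2026, §10 Thm. 10.3 (c)(i) (proof), chunk p0028] -/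
theorem pow_le_pow_succ_of_one_mem {M : Submodule ℤ (Π i, L i)} (h1 : (1 : Π i, L i) ∈ M) (m : ℕ) :
    M ^ m ≤ M ^ (m + 1) := fun x hx => by
  rw [pow_succ, ← mul_one x]
  exact Submodule.mul_mem_mul hx h1

omit [∀ i, NumberField (L i)] in
/-- `1 ∈ M ⟹ (M^m)_m` is increasing. [cite: HertlingLarabi2026, §10 Thm. 10.3 (c)(i), chunk p0028] -/
theorem pow_le_pow_of_one_mem {M : Submodule ℤ (Π i, L i)} (h1 : (1 : Π i, L i) ∈ M) {a b : ℕ} (hab : a ≤ b) :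
    M ^ a ≤ M ^ b := by
  induction hab with
  | refl => exact le_rfl
  | step _ ih => exact ih.trans (pow_le_pow_succ_of_one_mem h1 _)

omit [∀ i, NumberField (L i)] in
/-- `1 ∈ M ⟹ 1 ∈ M^m`. [cite: HertlingLarabi2026, §10 Thm. 10.3 (c)(ii) («`1_A ∈ L_2^N`»), chunk p0028] -/
theorem one_mem_pow_of_one_mem {M : Submodule ℤ (Π i, L i)} (h1 : (1 : Π i, L i) ∈ M) (m : ℕ) :
    (1 : Π i, L i) ∈ M ^ m := by
  induction m with
  | zero => rw [pow_zero]; exact Submodule.one_le.1 le_rfl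
  | succ m ih => rw [pow_succ, ← mul_one (1 : Π i, L i)]; exact Submodule.mul_mem_mul ih h1

omit [∀ i, NumberField (L i)] in
/-- `M ⊆ Λ` for an order `Λ` ⟹ `M^m ⊆ Λ` for every `m` («As each power `L^m` is contained in `Λ`»).
[cite: HertlingLarabi2026, §10 Thm. 10.3 (c)(i) (proof: «because each `L_2^l ⊂ Λ`»), chunk p0028] -/
theorem pow_le_of_le_order {M Λ : Submodule ℤ (Π i, L i)} (h1Λ : (1 : Π i, L i) ∈ Λ) (hΛΛ : Λ * Λ ≤ Λ)
    (hMΛ : M ≤ Λ) (m : ℕ) : M ^ m ≤ Λ := by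
  induction m with
  | zero => rw [pow_zero]; exact Submodule.one_le.2 h1Λ
  | succ m ih => rw [pow_succ]; exact (mul_le_mul' ih hMΛ).trans hΛΛ

/-- Positive powers of a full lattice are full lattices. [cite: HertlingLarabi2026, §5 Lemma 5.2 (a), chunk p0011] -/
theorem isFullLattice_pow_succ {M : Submodule ℤ (Π i, L i)} (hM : IsFullLattice (Π i, L i) M) (m : ℕ) :
    IsFullLattice (Π i, L i) (M ^ (m + 1)) := by
  induction m with
  | zero => rwa [zero_add, pow_one]
  | succ m ih => rw [pow_succ]; exact isFullLattice_mul ih hM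

omit [∀ i, NumberField (L i)] in
/-- **HL26 LEMMA 4.6 ∕ THM. 10.3 (c)(i): for a full lattice `M` with `1 ∈ M ⊆ Λ`, `Λ` an order, the increasing
sequence `M ⊆ M² ⊆ M³ ⊆ ⋯` becomes stationary: `M^{N+l} = M^N` for all `l`** («The sequence `(L_2^l)_{l∈ℕ}` of full
lattices is increasing and becomes stationary»: the powers lie in the finitely generated `ℤ`-module `Λ`, Noetherian).
[cite: HertlingLarabi2026, §10 Thm. 10.3 (c)(i), chunk p0028] [cite: DadeTausskyZassenhaus1962, §1.5 (Dedekind's observation, as cited by HL26 Lemma 4.6)] -/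
theorem exists_forall_pow_add_eq {M Λ : Submodule ℤ (Π i, L i)} (hΛ : IsFullLattice (Π i, L i) Λ)
    (h1Λ : (1 : Π i, L i) ∈ Λ) (hΛΛ : Λ * Λ ≤ Λ) (h1 : (1 : Π i, L i) ∈ M) (hMΛ : M ≤ Λ) :
    ∃ N : ℕ, ∀ l : ℕ, M ^ (N + l) = M ^ N := by
  haveI : IsNoetherian ℤ Λ := isNoetherian_of_fg_of_noetherian _ hΛ.1
  let a : ℕ →o Submodule ℤ Λ :=
    ⟨fun m => (M ^ m).comap Λ.subtype, fun i j hij => Submodule.comap_mono (pow_le_pow_of_one_mem h1 hij)⟩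
  obtain ⟨N, hN⟩ := monotone_stabilizes_iff_noetherian.2 inferInstance a
  have key : ∀ m, (a m).map Λ.subtype = M ^ m := fun m => by
    change ((M ^ m).comap Λ.subtype).map Λ.subtype = M ^ m
    rw [Submodule.map_comap_eq, Submodule.range_subtype, inf_eq_right.2 (pow_le_of_le_order h1Λ hΛΛ hMΛ m)]
  refine ⟨N, fun l => ?_⟩
  calc M ^ (N + l) = (a (N + l)).map Λ.subtype := (key _).symm
    _ = (a N).map Λ.subtype := by rw [hN (N + l) (Nat.le_add_right N l)]
    _ = M ^ N := key N

omit [∀ i, NumberField (L i)] in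
/-- Once stationary, always stationary: `M^{N+l} = M^N` for all `l` ⟹ `M^m = M^N` for every `m ≥ N`.
[cite: HertlingLarabi2026, §10 Thm. 10.3 (c)(i), chunk p0028] -/
theorem pow_eq_pow_of_le {M : Submodule ℤ (Π i, L i)} {N m : ℕ} (hstab : ∀ l : ℕ, M ^ (N + l) = M ^ N)
    (h : N ≤ m) : M ^ m = M ^ N := by
  obtain ⟨l, rfl⟩ := Nat.exists_eq_add_of_le h
  exact hstab l

omit [∀ i, NumberField (L i)] in
/-- `M ⊆ M^N` at the stationary exponent (also for `N = 0`: then `M = M^1 = M^0`). [cite: HertlingLarabi2026, §10 Thm. 10.3 (c), chunk p0028] -/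
theorem le_pow_of_forall_pow_add_eq {M : Submodule ℤ (Π i, L i)} (h1 : (1 : Π i, L i) ∈ M) {N : ℕ}
    (hstab : ∀ l : ℕ, M ^ (N + l) = M ^ N) : M ≤ M ^ N := by
  calc M = M ^ 1 := (pow_one M).symm
    _ ≤ M ^ (N + 1) := pow_le_pow_of_one_mem h1 (Nat.le_add_left 1 N)
    _ = M ^ N := hstab 1

omit [∀ i, NumberField (L i)] in
/-- **THM. 10.3 (c)(ii) ∕ LEMMA 4.6: the stationary power `Λ_2 := M^N` is an ORDER — `1 ∈ M^N`, `M^N·M^N = M^N` — with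
`M·M^N = M^N`** («`Λ_2 := L_2^N` is an order because `1_A ∈ L_2^N` and `L_2^N·L_2^N = L_2^N`»; «`L^l` is an order with
`L·L^l = L^l`»). [cite: HertlingLarabi2026, §10 Thm. 10.3 (c)(ii), chunk p0028] -/
theorem pow_isOrder_of_forall_pow_add_eq {M : Submodule ℤ (Π i, L i)} (h1 : (1 : Π i, L i) ∈ M) {N : ℕ}
    (hstab : ∀ l : ℕ, M ^ (N + l) = M ^ N) :
    (1 : Π i, L i) ∈ M ^ N ∧ M ^ N * M ^ N = M ^ N ∧ M * M ^ N = M ^ N ∧ M ^ N / M ^ N = M ^ N := by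
  have hmul : M ^ N * M ^ N = M ^ N := by rw [← pow_add, hstab]
  refine ⟨one_mem_pow_of_one_mem h1 N, hmul, ?_, div_self_eq_of_one_mem (one_mem_pow_of_one_mem h1 N) hmul.le⟩
  rw [mul_comm, ← pow_succ, hstab 1]

omit [∀ i, NumberField (L i)] in
/-- The stationary power `M^N` is INVERTIBLE (an order `Λ` satisfies `Λ·(𝒪(Λ):Λ) = 𝒪(Λ) = Λ`).
[cite: HertlingLarabi2026, §10 Thm. 10.3 (c)(ii) with §5 Thm. 5.6 (a), chunks p0028, p0012] -/
theorem pow_mul_div_div_eq_of_forall_pow_add_eq {M : Submodule ℤ (Π i, L i)} (h1 : (1 : Π i, L i) ∈ M) {N : ℕ}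
    (hstab : ∀ l : ℕ, M ^ (N + l) = M ^ N) : M ^ N * ((M ^ N / M ^ N) / M ^ N) = M ^ N / M ^ N :=
  mul_div_div_eq_of_one_mem (one_mem_pow_of_one_mem h1 N) (pow_isOrder_of_forall_pow_add_eq h1 hstab).2.1.le

/-- **HL26 LEMMA 4.6 (last clause): the powers `M^j`, `j ≥ 1`, BELOW the stationary one are NOT invertible** («If for
some `j ∈ {1,…,l−1}` `L^j` were invertible, then `𝒪(L^j) = 𝒪(L^{jm}) = 𝒪(L^l) = L^l` for `jm ≥ l`, so
`L^j = L^j·𝒪(L^j) = L^{j+l} = L^l`, a contradiction»; orders of products of invertible lattices multiply, g31-#9).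
[cite: HertlingLarabi2026, §10 (Thm. 10.1 context); HL26 = Hertling–Larabi, *Conjugacy classes of regular integer matrices*, arXiv:2602.15748, Lemma 4.6, chunk p0007] -/
theorem pow_mul_div_div_ne_of_ne_pow {M : Submodule ℤ (Π i, L i)} (hM : IsFullLattice (Π i, L i) M)
    (h1 : (1 : Π i, L i) ∈ M) {N : ℕ} (hstab : ∀ l : ℕ, M ^ (N + l) = M ^ N) {j : ℕ} (hj : 1 ≤ j)
    (hne : M ^ j ≠ M ^ N) : M ^ j * ((M ^ j / M ^ j) / M ^ j) ≠ M ^ j / M ^ j := by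
  intro hinv
  have hfull : IsFullLattice (Π i, L i) (M ^ j) := by
    obtain ⟨j', rfl⟩ := Nat.exists_eq_add_of_le' hj
    exact isFullLattice_pow_succ hM j'
  -- the powers `(M^j)^{m+1}` are invertible with order `𝒪(M^j)`
  have hpow : ∀ m : ℕ, (M ^ j) ^ (m + 1) / (M ^ j) ^ (m + 1) = M ^ j / M ^ j ∧
      (M ^ j) ^ (m + 1) * (((M ^ j) ^ (m + 1) / (M ^ j) ^ (m + 1)) / (M ^ j) ^ (m + 1)) =
        (M ^ j) ^ (m + 1) / (M ^ j) ^ (m + 1) := by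
    intro m
    induction m with
    | zero => rw [zero_add, pow_one]; exact ⟨rfl, hinv⟩
    | succ m ih =>
      have hf : IsFullLattice (Π i, L i) ((M ^ j) ^ (m + 1)) := isFullLattice_pow_succ hfull m
      rw [pow_succ]
      exact ⟨div_self_mul_eq_of_mul_div_eq_of_div_self_eq hf hfull ih.2 hinv ih.1 rfl,
        mul_invertible_of_mul_div_eq hf hfull ih.2 hinv⟩
  obtain ⟨hO, -⟩ := hpow N
  have hle : N ≤ j * (N + 1) := (Nat.le_succ N).trans (Nat.le_mul_of_pos_left (N + 1) hj)
  rw [← pow_mul, pow_eq_pow_of_le hstab hle, (pow_isOrder_of_forall_pow_add_eq h1 hstab).2.2.2] at hO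
  -- `hO : M^N = 𝒪(M^j)`, so `M^j = 𝒪(M^j)·M^j = M^{N+j} = M^N`
  apply hne
  calc M ^ j = (M ^ j / M ^ j) * M ^ j := (div_self_mul_self _).symm
    _ = M ^ N * M ^ j := by rw [← hO]
    _ = M ^ (N + j) := (pow_add _ _ _).symm
    _ = M ^ N := hstab j

/-! ## §2 The bound `N ≤ n − 1`, `n = dim_ℚ Y` (HL 2026 Thm. 10.3 (d); DTZ62 Theorem C): chains of lattices between
`pΛ_2` and `Λ_2` have length `≤ n`, the chain `(M^l + pΛ_2)_l` increases strictly until it reaches `Λ_2`, and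
starts above `ℤ·1 + pΛ_2`; then `Λ_2/M^{n−1}` is `p`-divisible for every prime `p`, hence `0` -/

omit [∀ i, NumberField (L i)] in
/-- `x ∈ (ℤp)·N ⟺ x = p·y` for some `y ∈ N` (file-local spelling of `pN`). [folklore] -/
private theorem mem_span_natCast_mul_iff {p : ℕ} {N : Submodule ℤ (Π i, L i)} {x : Π i, L i} :
    x ∈ Submodule.span ℤ {(p : Π i, L i)} * N ↔ ∃ y ∈ N, x = (p : ℤ) • y := by
  rw [Submodule.mem_span_singleton_mul]
  constructor
  · rintro ⟨z, hz, rfl⟩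
    exact ⟨z, hz, by rw [zsmul_eq_mul, Int.cast_natCast]⟩
  · rintro ⟨y, hy, rfl⟩
    exact ⟨y, hy, by rw [zsmul_eq_mul, Int.cast_natCast]⟩

omit [∀ i, NumberField (L i)] in
/-- `(ℤp)·N ⊆ N`. [folklore] -/
private theorem span_natCast_mul_le (p : ℕ) (N : Submodule ℤ (Π i, L i)) :
    Submodule.span ℤ {(p : Π i, L i)} * N ≤ N := fun x hx => by
  obtain ⟨y, hy, rfl⟩ := mem_span_natCast_mul_iff.1 hx
  exact N.smul_mem _ hy

/-- **NAKAYAMA STEP: a full lattice `Λ` with `Λ ⊆ ℤ·1 + pΛ` forces `dim_ℚ Y ≤ 1`** (the finitely generated module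
`Λ/(Λ ∩ ℤ1)` equals `p` times itself, so some `r ≡ 1 (mod p)` pushes `Λ`, hence `Y = ℚΛ`, into the line `ℚ·1`) —
HL's «`(L_2 + pΛ_2)/pΛ_2` has 𝔽_p-dimension at least 2, because else `𝔽_p[1_A] = Λ_2/pΛ_2`, a contradiction».
[cite: HertlingLarabi2026, §10 Thm. 10.3 (d) (proof), chunk p0028] -/
theorem finrank_le_one_of_le_one_sup_span_natCast_mul {Λ : Submodule ℤ (Π i, L i)}
    (hΛ : IsFullLattice (Π i, L i) Λ) {p : ℕ} (hp : p.Prime)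
    (h : Λ ≤ 1 ⊔ Submodule.span ℤ {(p : Π i, L i)} * Λ) : finrank ℚ (Π i, L i) ≤ 1 := by
  let π : (Π i, L i) →ₗ[ℤ] (Π i, L i) ⧸ (1 : Submodule ℤ (Π i, L i)) := (1 : Submodule ℤ (Π i, L i)).mkQ
  have hN : (Λ.map π).FG := hΛ.1.map _
  have hle : Λ.map π ≤ (Ideal.span {(p : ℤ)}) • Λ.map π := by
    rintro _ ⟨x, hx, rfl⟩
    obtain ⟨a, ha, y, hy, rfl⟩ := Submodule.mem_sup.1 (h hx)
    obtain ⟨z, hz, rfl⟩ := mem_span_natCast_mul_iff.1 hy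
    have ha0 : π a = 0 := (Submodule.Quotient.mk_eq_zero _).2 ha
    rw [map_add, ha0, zero_add, map_zsmul]
    exact Submodule.smul_mem_smul (Ideal.mem_span_singleton_self _) (Submodule.mem_map_of_mem hz)
  obtain ⟨r, hr1, hr⟩ := Submodule.exists_sub_one_mem_and_smul_eq_zero_of_fg_of_le_smul _ _ hN hle
  have hr0 : r ≠ 0 := by
    rintro rfl
    rw [zero_sub, Ideal.mem_span_singleton, dvd_neg] at hr1
    have h1 : (p : ℤ) = 1 := Int.eq_one_of_dvd_one (Int.natCast_nonneg p) hr1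
    exact hp.one_lt.ne' (by exact_mod_cast h1)
  -- every element of `Y` lies on the line `ℚ·1`
  have hline : ∀ y : Π i, L i, y ∈ Submodule.span ℚ {(1 : Π i, L i)} := fun y => by
    obtain ⟨m, hm, hmy⟩ := hΛ.2 y
    have h0 : π (r • (m • y)) = 0 := by rw [map_zsmul]; exact hr _ (Submodule.mem_map_of_mem hmy)
    have h0' : r • (m • y) ∈ (1 : Submodule ℤ (Π i, L i)) := (Submodule.Quotient.mk_eq_zero _).1 h0
    rw [Submodule.one_eq_span, Submodule.mem_span_singleton] at h0'
    obtain ⟨k, hk⟩ := h0'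
    have hk' : ((r * m : ℤ) : ℚ) • y = ((k : ℤ) : ℚ) • (1 : Π i, L i) := by
      rw [Int.cast_smul_eq_zsmul, Int.cast_smul_eq_zsmul, mul_smul, hk]
    rw [Submodule.mem_span_singleton]
    refine ⟨((r * m : ℤ) : ℚ)⁻¹ * k, ?_⟩
    rw [mul_smul, ← hk', smul_smul, inv_mul_cancel₀ (by exact_mod_cast mul_ne_zero hr0 hm), one_smul]
  have htop : (⊤ : Submodule ℚ (Π i, L i)) = Submodule.span ℚ {(1 : Π i, L i)} :=
    (top_le_iff.1 fun y _ => hline y).symm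
  rw [← finrank_top ℚ (Π i, L i), htop]
  exact (finrank_span_le_card _).trans (by simp)

/-- **`[Λ : pΛ] = p^{dim_ℚ Y}` for a full lattice `Λ`** (`Λ ≅ ℤ^n` on a `ℚ`-basis of `Y` spanning `Λ`, and
`|det(p·1_Λ)| = p^n`): `Λ/pΛ` is an `n`-dimensional `𝔽_p`-vector space. [cite: HertlingLarabi2026, §10 Thm. 10.3 (d) (proof: «the `n`-dimensional 𝔽_p-vector space `Λ_2/pΛ_2`»), chunk p0028] -/
theorem relIndex_span_natCast_mul_eq_pow {Λ : Submodule ℤ (Π i, L i)} (hΛ : IsFullLattice (Π i, L i) Λ)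
    {p : ℕ} (hp : p ≠ 0) :
    (Submodule.span ℤ {(p : Π i, L i)} * Λ).toAddSubgroup.relIndex Λ.toAddSubgroup = p ^ finrank ℚ (Π i, L i) := by
  classical
  obtain ⟨m, hm⟩ := exists_basis_fin_span_eq_of_isFullLattice hΛ
  let b : Basis (Fin (finrank ℚ (Π i, L i))) ℤ Λ := (Basis.restrictScalars ℤ m).map (LinearEquiv.ofEq _ _ hm)
  haveI : Module.Free ℤ Λ := Module.Free.of_basis b
  haveI : Module.Finite ℤ Λ := Module.Finite.of_basis b
  have hrank : finrank ℤ Λ = finrank ℚ (Π i, L i) := by rw [finrank_eq_card_basis b, Fintype.card_fin]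
  -- multiplication by `p` is an isomorphism `Λ ≅ pΛ`
  have hinj : Function.Injective fun v : Λ => (p : ℤ) • v := fun v w hvw => by
    have h' : ((p : ℤ) : ℚ) • (v : Π i, L i) = ((p : ℤ) : ℚ) • (w : Π i, L i) := by
      rw [Int.cast_smul_eq_zsmul, Int.cast_smul_eq_zsmul, ← Submodule.coe_smul, ← Submodule.coe_smul]
      exact congrArg Subtype.val hvw
    exact Subtype.ext (smul_right_injective (Π i, L i) (by exact_mod_cast hp : ((p : ℤ) : ℚ) ≠ 0) h')
  let e : Λ ≃ₗ[ℤ] ((p : ℤ) • (⊤ : Submodule ℤ Λ) : Submodule ℤ Λ) :=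
    LinearEquiv.ofBijective (((p : ℤ) • (LinearMap.id : Λ →ₗ[ℤ] Λ)).codRestrict ((p : ℤ) • (⊤ : Submodule ℤ Λ))
        fun v => Submodule.smul_mem_pointwise_smul v (p : ℤ) ⊤ Submodule.mem_top)
      ⟨fun v w hvw => hinj (Subtype.ext_iff.1 hvw), fun w => by
        obtain ⟨v, -, hv⟩ := (Submodule.mem_smul_pointwise_iff_exists (w : Λ) (p : ℤ) ⊤).1 w.2
        exact ⟨v, Subtype.ext hv⟩⟩
  have hdet := Submodule.natAbs_det_equiv ((p : ℤ) • (⊤ : Submodule ℤ Λ)) e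
  have hcomp : ((p : ℤ) • (⊤ : Submodule ℤ Λ)).subtype ∘ₗ
      ((e : Λ →+ ((p : ℤ) • (⊤ : Submodule ℤ Λ) : Submodule ℤ Λ))).toIntLinearMap =
        (p : ℤ) • (LinearMap.id : Λ →ₗ[ℤ] Λ) :=
    LinearMap.ext fun v => rfl
  rw [hcomp, LinearMap.det_smul, LinearMap.det_id, mul_one, Int.natAbs_pow, Int.natAbs_natCast, hrank] at hdet
  -- `pΛ ∩ Λ`, as a subgroup of `Λ`, is `p·⊤`
  have hof : (Submodule.span ℤ {(p : Π i, L i)} * Λ).toAddSubgroup.addSubgroupOf Λ.toAddSubgroup =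
      ((p : ℤ) • (⊤ : Submodule ℤ Λ)).toAddSubgroup := by
    ext v
    rw [AddSubgroup.mem_addSubgroupOf, Submodule.mem_toAddSubgroup, Submodule.mem_toAddSubgroup,
      Submodule.mem_smul_pointwise_iff_exists]
    change (v : Π i, L i) ∈ Submodule.span ℤ {(p : Π i, L i)} * Λ ↔ _
    rw [mem_span_natCast_mul_iff]
    constructor
    · rintro ⟨y, hy, hvy⟩
      exact ⟨⟨y, hy⟩, Submodule.mem_top, Subtype.ext (by rw [Submodule.coe_smul]; exact hvy.symm)⟩
    · rintro ⟨w, -, hwv⟩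
      exact ⟨w, w.2, by rw [← hwv, Submodule.coe_smul]⟩
  rw [AddSubgroup.relIndex, hof, AddSubgroup.index]
  exact hdet.symm

/-- **A strictly increasing chain `V_0 ⊊ V_1 ⊊ ⋯ ⊊ V_k` of lattices between `pΛ` and `Λ` has length `k ≤ dim_ℚ Y`**
(each index `[V_{j+1} : V_j] ≠ 1` divides `[Λ : pΛ] = p^n`, so is a positive power of `p`, and their product divides
`p^n`) — the `𝔽_p`-dimension count of HL's proof of Thm. 10.3 (d). [cite: HertlingLarabi2026, §10 Thm. 10.3 (d) (proof), chunk p0028] -/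
theorem chain_length_le_finrank {Λ : Submodule ℤ (Π i, L i)} (hΛ : IsFullLattice (Π i, L i) Λ) {p : ℕ}
    (hp : p.Prime) (V : ℕ → Submodule ℤ (Π i, L i)) {k : ℕ} (h0 : Submodule.span ℤ {(p : Π i, L i)} * Λ ≤ V 0)
    (hk : V k ≤ Λ) (hlt : ∀ j < k, V j < V (j + 1)) : k ≤ finrank ℚ (Π i, L i) := by
  have hmono : ∀ i j, i ≤ j → j ≤ k → V i ≤ V j := by
    intro i j hij hjk
    induction hij with
    | refl => exact le_rfl
    | step h ih => exact (ih (Nat.le_of_succ_le hjk)).trans (hlt _ (Nat.lt_of_succ_le hjk)).le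
  have hpn := relIndex_span_natCast_mul_eq_pow hΛ hp.ne_zero
  -- every relative index along the chain divides `p^n`
  have hdvd_tot : ∀ i j, i ≤ j → j ≤ k →
      (V i).toAddSubgroup.relIndex (V j).toAddSubgroup ∣ p ^ finrank ℚ (Π i, L i) := by
    intro i j hij hjk
    have hPi : (Submodule.span ℤ {(p : Π i, L i)} * Λ).toAddSubgroup ≤ (V i).toAddSubgroup :=
      (Submodule.toAddSubgroup_le _ _).2 (h0.trans (hmono 0 i (Nat.zero_le i) (hij.trans hjk)))
    have hjΛ : (V j).toAddSubgroup ≤ Λ.toAddSubgroup := (Submodule.toAddSubgroup_le _ _).2 ((hmono j k hjk le_rfl).trans hk)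
    rw [← hpn]
    calc (V i).toAddSubgroup.relIndex (V j).toAddSubgroup
        ∣ (Submodule.span ℤ {(p : Π i, L i)} * Λ).toAddSubgroup.relIndex (V j).toAddSubgroup :=
          AddSubgroup.relIndex_dvd_of_le_left _ hPi
      _ ∣ (Submodule.span ℤ {(p : Π i, L i)} * Λ).toAddSubgroup.relIndex Λ.toAddSubgroup :=
          Dvd.intro _ (AddSubgroup.relIndex_mul_relIndex _ _ _ (hPi.trans ((Submodule.toAddSubgroup_le _ _).2
            (hmono i j hij hjk))) hjΛ)
  have hdiv : ∀ j ≤ k, p ^ j ∣ (V 0).toAddSubgroup.relIndex (V j).toAddSubgroup := by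
    intro j hj
    induction j with
    | zero => rw [pow_zero]; exact one_dvd _
    | succ j ih =>
      have hj' : j ≤ k := Nat.le_of_succ_le hj
      rw [← AddSubgroup.relIndex_mul_relIndex (V 0).toAddSubgroup (V j).toAddSubgroup (V (j + 1)).toAddSubgroup
        ((Submodule.toAddSubgroup_le _ _).2 (hmono 0 j (Nat.zero_le j) hj'))
        ((Submodule.toAddSubgroup_le _ _).2 (hlt j (Nat.lt_of_succ_le hj)).le), pow_succ]
      refine mul_dvd_mul (ih hj') ?_
      obtain ⟨i, -, hri⟩ := (Nat.dvd_prime_pow hp).1 (hdvd_tot j (j + 1) (Nat.le_succ j) hj)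
      rw [hri]
      rcases i with _ | i
      · exfalso
        rw [pow_zero, AddSubgroup.relIndex_eq_one, Submodule.toAddSubgroup_le] at hri
        exact absurd hri (not_le_of_gt (hlt j (Nat.lt_of_succ_le hj)))
      · exact dvd_pow_self p (Nat.succ_ne_zero i)
  exact (Nat.pow_dvd_pow_iff_le_right hp.one_lt).1 ((hdiv k le_rfl).trans (hdvd_tot 0 k (Nat.zero_le k) le_rfl))


omit [∀ i, NumberField (L i)] in
/-- **`Λ_2 ⊆ A + dΛ_2` for every `d ≥ 1` once it holds for every PRIME `d`**, and then **`Λ_2 ⊆ A`** when `A` is a full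
lattice (some `e ≠ 0` has `eΛ_2 ⊆ A`): a finitely generated `ℤ`-module `Λ_2/A ∩ Λ_2` which is `p`-divisible for every
prime `p` and killed by `e ≠ 0` vanishes — HL's passage from «`L_2^{N_0+l} + pΛ_2 = Λ_2` … for each `p`» to
«`L_2^{N_0+l} = Λ_2`» (there by Nakayama and `L = ⋂_p L_(p)`). [cite: HertlingLarabi2026, §10 Thm. 10.3 (d) (end of proof), chunk p0028] -/
theorem le_of_forall_prime_le_sup_span_natCast_mul {A Λ₂ : Submodule ℤ (Π i, L i)}
    (hA : IsFullLattice (Π i, L i) A) (hΛ₂ : Λ₂.FG)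
    (h : ∀ p : ℕ, p.Prime → Λ₂ ≤ A ⊔ Submodule.span ℤ {(p : Π i, L i)} * Λ₂) : Λ₂ ≤ A := by
  have hd : ∀ d : ℕ, d ≠ 0 → Λ₂ ≤ A ⊔ Submodule.span ℤ {(d : Π i, L i)} * Λ₂ := by
    intro d
    induction d using Nat.strong_induction_on with
    | _ d ih =>
      intro hd0
      rcases Nat.lt_or_ge d 2 with hd2 | hd2
      · obtain rfl : d = 1 := by omega
        intro x hx
        exact Submodule.mem_sup_right (mem_span_natCast_mul_iff.2 ⟨x, hx, by rw [Nat.cast_one, one_smul]⟩)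
      · have hp : d.minFac.Prime := Nat.minFac_prime (by omega)
        obtain ⟨d', hd'⟩ : d.minFac ∣ d := Nat.minFac_dvd d
        have hd'0 : d' ≠ 0 := by
          rintro rfl
          rw [mul_zero] at hd'
          exact hd0 hd'
        have hd'lt : d' < d := by
          have h2 := hp.two_le
          have h1 : 1 ≤ d' := Nat.one_le_iff_ne_zero.2 hd'0
          calc d' < 2 * d' := by omega
            _ ≤ d.minFac * d' := Nat.mul_le_mul_right d' h2
            _ = d := hd'.symm
        intro x hx
        obtain ⟨a, ha, y, hy, rfl⟩ := Submodule.mem_sup.1 (h _ hp hx)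
        obtain ⟨z, hz, rfl⟩ := mem_span_natCast_mul_iff.1 hy
        obtain ⟨a', ha', y', hy', rfl⟩ := Submodule.mem_sup.1 (ih d' hd'lt hd'0 hz)
        obtain ⟨w, hw, rfl⟩ := mem_span_natCast_mul_iff.1 hy'
        rw [smul_add, ← add_assoc, smul_smul]
        refine Submodule.add_mem _ (Submodule.mem_sup_left (A.add_mem ha (A.smul_mem _ ha')))
          (Submodule.mem_sup_right (mem_span_natCast_mul_iff.2 ⟨w, hw, ?_⟩))
        rw [← Nat.cast_mul, ← hd']
  obtain ⟨e, he, heA⟩ := exists_smul_mem_of_fg hA hΛ₂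
  refine (hd e.natAbs (Int.natAbs_ne_zero.2 he)).trans (sup_le le_rfl fun x hx => ?_)
  obtain ⟨y, hy, rfl⟩ := mem_span_natCast_mul_iff.1 hx
  rcases Int.natAbs_eq e with h' | h'
  · rw [← h']
    exact heA y hy
  · rw [show ((e.natAbs : ℕ) : ℤ) = -e by omega, neg_smul]
    exact A.neg_mem (heA y hy)

omit [∀ i, NumberField (L i)] in
/-- Stationarity at `N` implies stationarity at `N + 1`. [cite: HertlingLarabi2026, §10 Thm. 10.3 (c)(i), chunk p0028] -/
theorem forall_pow_succ_add_eq {M : Submodule ℤ (Π i, L i)} {N : ℕ} (hstab : ∀ l : ℕ, M ^ (N + l) = M ^ N)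
    (l : ℕ) : M ^ (N + 1 + l) = M ^ (N + 1) := by
  rw [pow_eq_pow_of_le hstab (by omega : N ≤ N + 1 + l), pow_eq_pow_of_le hstab (Nat.le_succ N)]

/-- **THM. 10.3 (d), ONE PRIME: `M^{n−1} + pΛ_2 = Λ_2`** for a full lattice `M ∋ 1` whose powers become stationary at the
order `Λ_2 = M^{N+1}`, `n = dim_ℚ Y ≥ 2`, `p` any prime.  HL's proof: the chain `(M^l + pΛ_2)/pΛ_2` of subspaces of the
`n`-dimensional `𝔽_p`-space `Λ_2/pΛ_2` increases STRICTLY until it is stationary («if `(L_2^m + pΛ_2) = (L_2^{m+1} + pΛ_2)`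
then `(L_2^m + pΛ_2) = (L_2^{m+l} + pΛ_2)` for each `l ≥ 1`»), it ends at `Λ_2/pΛ_2`, and it starts in dimension `≥ 2`
(«because else `𝔽_p[1_A] = Λ_2/pΛ_2`, a contradiction»); «Therefore `N_p ≤ n − 1`».  Here the dimensions are replaced
by the indices of `chain_length_le_finrank` applied to `pΛ_2 ⊊ ℤ1 + pΛ_2 ⊊ M + pΛ_2 ⊊ M² + pΛ_2 ⊊ ⋯`.
[cite: HertlingLarabi2026, §10 Thm. 10.3 (d) (proof), chunk p0028] [cite: DadeTausskyZassenhaus1962, §1.5 Theorem C (the bound `n − 1`)] -/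
theorem pow_finrank_sub_one_sup_span_natCast_mul_eq {M : Submodule ℤ (Π i, L i)}
    (hM : IsFullLattice (Π i, L i) M) (h1 : (1 : Π i, L i) ∈ M) {N : ℕ}
    (hstab : ∀ l : ℕ, M ^ (N + 1 + l) = M ^ (N + 1)) (hn : 2 ≤ finrank ℚ (Π i, L i)) {p : ℕ} (hp : p.Prime) :
    M ^ (finrank ℚ (Π i, L i) - 1) ⊔ Submodule.span ℤ {(p : Π i, L i)} * M ^ (N + 1) = M ^ (N + 1) := by
  obtain ⟨h1Λ, hΛΛ, hMΛ, -⟩ := pow_isOrder_of_forall_pow_add_eq h1 hstab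
  have hΛf : IsFullLattice (Π i, L i) (M ^ (N + 1)) := isFullLattice_pow_succ hM N
  have hMle : M ≤ M ^ (N + 1) := le_pow_of_forall_pow_add_eq h1 hstab
  set Λ₂ : Submodule ℤ (Π i, L i) := M ^ (N + 1) with hΛ₂
  set P : Submodule ℤ (Π i, L i) := Submodule.span ℤ {(p : Π i, L i)} with hP
  have hPΛ : P * Λ₂ ≤ Λ₂ := span_natCast_mul_le p Λ₂
  -- the chain `W_l = M^l + pΛ_2`
  let W : ℕ → Submodule ℤ (Π i, L i) := fun l => M ^ l ⊔ P * Λ₂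
  have hWmono : ∀ {a b : ℕ}, a ≤ b → W a ≤ W b := fun hab => sup_le_sup_right (pow_le_pow_of_one_mem h1 hab) _
  have hWle : ∀ l, W l ≤ Λ₂ := fun l => sup_le (pow_le_of_le_order h1Λ hΛΛ.le hMle l) hPΛ
  have hWN : W (N + 1) = Λ₂ := le_antisymm (hWle _) le_sup_left
  -- once the chain stalls it stays constant
  have hstall : ∀ l, W (l + 1) ≤ W l → W (l + 2) ≤ W (l + 1) := fun l hl => by
    refine sup_le ?_ le_sup_right
    have hMl : M ^ (l + 1) ≤ W l := le_sup_left.trans hl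
    calc M ^ (l + 2) = M * M ^ (l + 1) := pow_succ' M (l + 1)
      _ ≤ M * W l := mul_le_mul_right hMl M
      _ = M * M ^ l ⊔ M * (P * Λ₂) := Submodule.mul_sup _ _ _
      _ = M ^ (l + 1) ⊔ P * (M * Λ₂) := by rw [← pow_succ', mul_left_comm]
      _ = M ^ (l + 1) ⊔ P * Λ₂ := by rw [hMΛ]
  have hconst : ∀ l, W (l + 1) ≤ W l → ∀ j, W (l + j + 1) ≤ W (l + j) := by
    intro l hl j
    induction j with
    | zero => exact hl
    | succ j ih => exact hstall (l + j) ih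
  have hconst' : ∀ l, W (l + 1) ≤ W l → ∀ j, W (l + j) ≤ W l := by
    intro l hl j
    induction j with
    | zero => exact le_rfl
    | succ j ih => exact (hconst l hl j).trans ih
  -- the first exponent `N_p` with `W_{N_p} = Λ_2`; below it the chain is strictly increasing
  have hex : ∃ l, W l = Λ₂ := ⟨N + 1, hWN⟩
  have hNp : W (Nat.find hex) = Λ₂ := Nat.find_spec hex
  have hlt : ∀ l < Nat.find hex, W l < W (l + 1) := fun l hl => by
    refine lt_of_le_of_ne (hWmono (Nat.le_succ l)) fun heq => Nat.find_min hex hl ?_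
    refine le_antisymm (hWle l) ?_
    calc Λ₂ = W (N + 1) := hWN.symm
      _ ≤ W (l + (N + 1)) := hWmono (Nat.le_add_left (N + 1) l)
      _ ≤ W l := hconst' l heq.symm.le (N + 1)
  -- `Λ_2 ⊄ ℤ1 + pΛ_2` since `n ≥ 2`
  have hX : ¬ Λ₂ ≤ 1 ⊔ P * Λ₂ := fun h =>
    absurd (finrank_le_one_of_le_one_sup_span_natCast_mul hΛf hp h) (by omega)
  -- step 0: `pΛ_2 ⊊ ℤ1 + pΛ_2` (`1 ∉ pΛ_2`, else `Λ_2 = Λ_2·1 ⊆ pΛ_2`)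
  have hstep0 : P * Λ₂ < 1 ⊔ P * Λ₂ := by
    refine lt_of_le_of_ne le_sup_right fun heq => hX fun x hx => ?_
    have h1P : (1 : Π i, L i) ∈ P * Λ₂ := by rw [heq]; exact Submodule.mem_sup_left (Submodule.one_le.1 le_rfl)
    have hx1 : x * 1 ∈ Λ₂ * (P * Λ₂) := Submodule.mul_mem_mul hx h1P
    rw [mul_one, mul_left_comm] at hx1
    exact Submodule.mem_sup_right ((mul_le_mul_right hΛΛ.le P) hx1)
  -- step 1: `ℤ1 + pΛ_2 ⊊ M + pΛ_2` (else all powers of `M` lie in the multiplicatively closed `ℤ1 + pΛ_2`)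
  have hstep1 : 1 ⊔ P * Λ₂ < W 1 := by
    refine lt_of_le_of_ne (sup_le_sup_right (by rw [pow_one]; exact Submodule.one_le.2 h1) _) fun heq => hX ?_
    have hB1 : (1 : Π i, L i) ∈ 1 ⊔ P * Λ₂ := Submodule.mem_sup_left (Submodule.one_le.1 le_rfl)
    have hBB : (1 ⊔ P * Λ₂) * (1 ⊔ P * Λ₂) ≤ 1 ⊔ P * Λ₂ := by
      rw [Submodule.mul_sup, Submodule.sup_mul, Submodule.sup_mul, one_mul, mul_one, one_mul]
      refine sup_le (sup_le le_sup_left le_sup_right) (sup_le le_sup_right ?_)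
      calc P * Λ₂ * (P * Λ₂) = P * (Λ₂ * (P * Λ₂)) := mul_assoc _ _ _
        _ ≤ P * Λ₂ := mul_le_mul_right ((mul_le_mul_right hPΛ Λ₂).trans hΛΛ.le) P
        _ ≤ 1 ⊔ P * Λ₂ := le_sup_right
    have hMB : M ≤ 1 ⊔ P * Λ₂ := by
      rw [heq]
      exact (pow_one M).symm.le.trans le_sup_left
    exact pow_le_of_le_order hB1 hBB hMB (N + 1)
  -- `N_p ≥ 1`
  obtain ⟨m, hm⟩ : ∃ m, Nat.find hex = m + 1 := by
    refine Nat.exists_eq_succ_of_ne_zero fun h0 => hX ?_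
    have hW0 : W 0 = Λ₂ := by simpa only [h0] using hNp
    have hW0' : W 0 ≤ 1 ⊔ P * Λ₂ := by
      change M ^ 0 ⊔ P * Λ₂ ≤ 1 ⊔ P * Λ₂
      rw [pow_zero]
    rwa [hW0] at hW0'
  -- the chain `pΛ_2 ⊊ ℤ1 + pΛ_2 ⊊ W_1 ⊊ W_2 ⊊ ⋯ ⊊ W_{N_p} = Λ_2` has length `N_p + 1 ≤ n`
  let V : ℕ → Submodule ℤ (Π i, L i) := fun j =>
    match j with
    | 0 => P * Λ₂
    | 1 => 1 ⊔ P * Λ₂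
    | j + 2 => W (j + 1)
  have hcount : m + 2 ≤ finrank ℚ (Π i, L i) := by
    refine chain_length_le_finrank hΛf hp V le_rfl ?_ ?_
    · change W (m + 1) ≤ Λ₂
      exact hWle _
    · intro j hj
      match j, hj with
      | 0, _ => exact hstep0
      | 1, _ => exact hstep1
      | i + 2, hi =>
        change W (i + 1) < W (i + 1 + 1)
        exact hlt (i + 1) (by omega)
  -- conclusion
  refine le_antisymm (hWle _) ?_
  calc Λ₂ = W (Nat.find hex) := hNp.symm
    _ ≤ W (finrank ℚ (Π i, L i) - 1) := hWmono (by omega)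

/-- **HL 2026 THM. 10.3 (c)+(d) ∕ DTZ62 THEOREM C (Dedekind's bound): for a full lattice `M` with `1 ∈ M ⊆ Λ`, `Λ` an
order of `Y`, `n = dim_ℚ Y ≥ 2`, ALL the powers `M^k`, `k ≥ n − 1`, coincide** (with the order `Λ_2 = M^N` at which the
chain `M ⊆ M² ⊆ ⋯` becomes stationary: «`L_2^{N_0+l} = Λ_2` for `l ≥ 0`», `N_0 ≤ n − 1`).  Sharp: for `Λ = ℤ[a]` and
`L = ⟨1, a, 2a², …, 2a^{n−1}⟩`, `L ⊊ L² ⊊ ⋯ ⊊ L^{n−1} = Λ` (DTZ62 ∕ HL26 Example 4.7, Dedekind). [cite: HertlingLarabi2026, §10 Thm. 10.3 (c)(d), chunk p0028] [cite: DadeTausskyZassenhaus1962, §1.5 Theorem C] -/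
theorem pow_eq_pow_finrank_sub_one_of_one_mem_le_order {M Λ : Submodule ℤ (Π i, L i)}
    (hM : IsFullLattice (Π i, L i) M) (h1 : (1 : Π i, L i) ∈ M) (hΛ : IsFullLattice (Π i, L i) Λ)
    (h1Λ : (1 : Π i, L i) ∈ Λ) (hΛΛ : Λ * Λ ≤ Λ) (hMΛ : M ≤ Λ) (hn : 2 ≤ finrank ℚ (Π i, L i)) {k : ℕ}
    (hk : finrank ℚ (Π i, L i) - 1 ≤ k) : M ^ k = M ^ (finrank ℚ (Π i, L i) - 1) := by
  obtain ⟨N, hstab⟩ := exists_forall_pow_add_eq hΛ h1Λ hΛΛ h1 hMΛ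
  have hstab' := forall_pow_succ_add_eq hstab
  obtain ⟨h1Λ₂, hΛΛ₂, -, -⟩ := pow_isOrder_of_forall_pow_add_eq h1 hstab'
  have hΛf : IsFullLattice (Π i, L i) (M ^ (N + 1)) := isFullLattice_pow_succ hM N
  have hMle : M ≤ M ^ (N + 1) := le_pow_of_forall_pow_add_eq h1 hstab'
  -- `M^{n-1} = M^{N+1}`
  obtain ⟨n', hn'⟩ : ∃ n', finrank ℚ (Π i, L i) - 1 = n' + 1 := Nat.exists_eq_succ_of_ne_zero (by omega)
  have hAf : IsFullLattice (Π i, L i) (M ^ (finrank ℚ (Π i, L i) - 1)) := by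
    rw [hn']
    exact isFullLattice_pow_succ hM n'
  have heq : M ^ (finrank ℚ (Π i, L i) - 1) = M ^ (N + 1) :=
    le_antisymm (pow_le_of_le_order h1Λ₂ hΛΛ₂.le hMle _)
      (le_of_forall_prime_le_sup_span_natCast_mul hAf hΛf.1 fun p hp =>
        (pow_finrank_sub_one_sup_span_natCast_mul_eq hM h1 hstab' hn hp).symm.le)
  refine le_antisymm ?_ (pow_le_pow_of_one_mem h1 hk)
  calc M ^ k ≤ M ^ (max k (N + 1)) := pow_le_pow_of_one_mem h1 (le_max_left _ _)
    _ = M ^ (N + 1) := pow_eq_pow_of_le hstab' (le_max_right _ _)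
    _ = M ^ (finrank ℚ (Π i, L i) - 1) := heq.symm

/-- **COROLLARY (THM. 10.3 (c)(d) assembled): for `1 ∈ M ⊆ Λ` as above and every `k ≥ n − 1`, `M^k` is an ORDER
(`1 ∈ M^k`, `M^k·M^k = M^k`, `𝒪(M^k) = M^k`), `M·M^k = M^k`, and `M^k` is INVERTIBLE** — «`L_2^{n−1+l} = Λ_2` for
`l ≥ 0`». [cite: HertlingLarabi2026, §10 Thm. 10.3 (c)(d) and proof of Thm. 10.1, chunk p0028] -/
theorem pow_isOrder_of_one_mem_le_order {M Λ : Submodule ℤ (Π i, L i)}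
    (hM : IsFullLattice (Π i, L i) M) (h1 : (1 : Π i, L i) ∈ M) (hΛ : IsFullLattice (Π i, L i) Λ)
    (h1Λ : (1 : Π i, L i) ∈ Λ) (hΛΛ : Λ * Λ ≤ Λ) (hMΛ : M ≤ Λ) (hn : 2 ≤ finrank ℚ (Π i, L i)) {k : ℕ}
    (hk : finrank ℚ (Π i, L i) - 1 ≤ k) :
    (1 : Π i, L i) ∈ M ^ k ∧ M ^ k * M ^ k = M ^ k ∧ M * M ^ k = M ^ k ∧ M ^ k / M ^ k = M ^ k ∧
      M ^ k * ((M ^ k / M ^ k) / M ^ k) = M ^ k / M ^ k ∧ IsFullLattice (Π i, L i) (M ^ k) := by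
  have hstab : ∀ l : ℕ, M ^ (k + l) = M ^ k := fun l => by
    rw [pow_eq_pow_finrank_sub_one_of_one_mem_le_order hM h1 hΛ h1Λ hΛΛ hMΛ hn hk,
      pow_eq_pow_finrank_sub_one_of_one_mem_le_order hM h1 hΛ h1Λ hΛΛ hMΛ hn (hk.trans (Nat.le_add_right k l))]
  obtain ⟨k', rfl⟩ : ∃ k', k = k' + 1 := Nat.exists_eq_succ_of_ne_zero (by omega)
  exact ⟨(pow_isOrder_of_forall_pow_add_eq h1 hstab).1, (pow_isOrder_of_forall_pow_add_eq h1 hstab).2.1,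
    (pow_isOrder_of_forall_pow_add_eq h1 hstab).2.2.1, (pow_isOrder_of_forall_pow_add_eq h1 hstab).2.2.2,
    pow_mul_div_div_eq_of_forall_pow_add_eq h1 hstab, isFullLattice_pow_succ hM k'⟩

/-! ## §3 Thm. 10.3 (a): a weakly equivalent `L_1` with `L_1Λ = Λ`, `L_1 ⊆ Λ` -/

/-- **HL 2026 THM. 10.3 (a): for a full lattice `L` and an order `Λ ⊇ 𝒪(L)` with `ΛL ∈ G(Λ)` there is a full lattice
`L_1 ∼_w L` with `L_1Λ = Λ` (hence `L_1 ⊆ Λ`)** — as printed: «By Theorem 8.2 (b) the map `G(𝒪(L)) → G(Λ), K ↦ ΛK`, is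
a surjective group homomorphism [the tree's `exists_invertible_order_mul_eq`]. Choose `K ∈ G(𝒪(L))` with `ΛK = ΛL`. Then
`L_1 := LK⁻¹` satisfies `L_1Λ = Λ` and `L_1 ∼_w L`, the last statement because of Theorem 5.8. Especially `L_1 ⊂ Λ`
because `1_A ∈ Λ`.»  (`∼_w` is spelled `1 ∈ (L:L_1)(L_1:L)`, g32-#1.) [cite: HertlingLarabi2026, §10 Thm. 10.3 (a) with proof, chunks p0027–p0028] -/
theorem exists_weak_mul_order_eq_order {M Λ : Submodule ℤ (Π i, L i)} (hM : IsFullLattice (Π i, L i) M)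
    (hΛ : IsFullLattice (Π i, L i) Λ) (h1Λ : (1 : Π i, L i) ∈ Λ) (hΛΛ : Λ * Λ ≤ Λ) (hle : M / M ≤ Λ)
    (hO : (Λ * M) / (Λ * M) = Λ) (hinv : (Λ * M) * (((Λ * M) / (Λ * M)) / (Λ * M)) = (Λ * M) / (Λ * M)) :
    ∃ L₁ : Submodule ℤ (Π i, L i), IsFullLattice (Π i, L i) L₁ ∧ (1 : Π i, L i) ∈ (M / L₁) * (L₁ / M) ∧
      L₁ * Λ = Λ ∧ L₁ ≤ Λ := by
  obtain ⟨K, hK, hKO, hKinv, hΛK⟩ := exists_invertible_order_mul_eq hΛΛ (isFullLattice_div hM hM)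
    (one_mem_div_self M) (div_self_mul_div_self_eq M).le hle (isFullLattice_mul hΛ hM) hO hinv
  -- `K⁻¹ = 𝒪(K):K`, invertible with `𝒪(K⁻¹) = 𝒪(K) = 𝒪(L)` and `KK⁻¹ = 𝒪(L)`
  have hK'O : ((K / K) / K) / ((K / K) / K) = M / M := by rw [div_div_self_of_mul_div_eq hKinv, hKO]
  have hK'inv : ((K / K) / K) * ((((K / K) / K) / ((K / K) / K)) / ((K / K) / K)) =
      ((K / K) / K) / ((K / K) / K) := by
    rw [hK'O, ← hKO]
    exact (inv_mul_div_eq_of_mul_div_eq hKinv).2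
  have hKK' : K * ((K / K) / K) = M / M := by rw [hKinv, hKO]
  have hprod : M * ((K / K) / K) * Λ = Λ :=
    calc M * ((K / K) / K) * Λ = ((K / K) / K) * (Λ * M) := by
          rw [mul_comm M, mul_assoc, mul_comm M]
      _ = ((K / K) / K) * (Λ * K) := by rw [hΛK]
      _ = Λ * (K * ((K / K) / K)) := by rw [mul_comm Λ K, ← mul_assoc, mul_comm _ K, mul_comm]
      _ = Λ * (M / M) := by rw [hKK']
      _ = Λ := order_mul_order_eq_of_le hΛΛ (one_mem_div_self M) hle
  refine ⟨M * ((K / K) / K), isFullLattice_mul hM (isFullLattice_div (isFullLattice_div hK hK) hK),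
    one_mem_div_mul_div_of_invertible_mul_eq hK'O hK'inv rfl, hprod, fun x hx => ?_⟩
  have hx1 : x * 1 ∈ M * ((K / K) / K) * Λ := Submodule.mul_mem_mul hx h1Λ
  rwa [mul_one, hprod] at hx1

/-! ## §4 Thm. 10.3 (b) for lattices with LOCAL GENERATORS: `L_2 ∼_w L` with `1 ∈ L_2 ⊆ Λ` -/

omit [∀ i, NumberField (L i)] in
/-- `u⁻¹·(s′·((u·(s·x))·1)) = (s′s)·x` (file-local bookkeeping). [folklore] -/
private theorem units_inv_smul_zsmul_eq (u : (Π i, L i)ˣ) (s s' : ℤ) (x : Π i, L i) :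
    (u⁻¹ : (Π i, L i)ˣ) • (s' • ((u • (s • x)) * 1)) = (s' * s) • x := by
  rw [mul_one, smul_comm (u⁻¹ : (Π i, L i)ˣ) s', inv_smul_smul, smul_smul]

/-- **THM. 10.3 (b), FOR A LATTICE WITH LOCAL GENERATORS IN ITSELF: if at every prime `p` where `L` and the order `Λ`
disagree some `c_p ∈ L ∩ Y^×` generates `LΛ` locally (`(LΛ)_(p) = c_pΛ_(p)`), then there is a full lattice `L_2` with
`L_2 ∼_w L`, `1 ∈ L_2` and `L_2 ⊆ Λ`.**  This is HL's construction «`b_p ∈ L_1 ⊂ Λ` with `b_p ∈ Λ_(p)^{unit}` … By Theorem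
7.3 there is a unique full lattice `L_2` with `(L_2)_(p) = b_p⁻¹(L_1)_(p)` for each `p`. By Remark 7.4 `L_2 ∼_w L_1`. By
construction `1_A = b_p⁻¹b_p ∈ (L_2)_(p)` for each `p`, so `1_A ∈ L_2`. For each `p` `(L_2)_(p) ⊂ Λ_(p)` … so `L_2 ⊂ Λ`»
(gluing = the tree's `exists_isFullLattice_forall_prime_locEq`, Thm. 7.2 (c); `∼_w` = its
`one_mem_div_mul_div_of_forall_prime_locEq_units_smul`, Rem. 7.4), run directly from `L` with the local generators `c_p`
in place of HL's `b_p`.  CAVEAT (why a hypothesis is needed): HL obtain `b_p` from «`(L_1+pΛ)/pΛ` is not contained in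
any one of these ideals … So it is also not contained in their union» — but `(L_1+pΛ)/pΛ` is only an `𝔽_p`-SUBSPACE, and
a subspace CAN lie in a union of `> p` proper ideals: for `A = ℚ³` (or a cubic field in which `2` splits completely),
`Λ = Λ_max`, `p = 2`, `L_1` = the preimage of `{000, 110, 011, 101} ⊂ 𝔽_2³`, one has `L_1Λ = Λ` but NO `L_2 ∼_w L_1` with
`1 ∈ L_2` inside an order exists; Thm. 10.3 (b) is false as printed there (Thm. 10.1 still holds: `L_1² = Λ`).
[cite: HertlingLarabi2026, §10 Thm. 10.3 (b) (proof, from «we can choose an element `b_p ∈ L_1`» on), chunk p0028] -/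
theorem exists_weak_one_mem_le_order_of_forall_exists_units_locEq {M Λ : Submodule ℤ (Π i, L i)}
    (hM : IsFullLattice (Π i, L i) M) (hΛ : IsFullLattice (Π i, L i) Λ) (h1Λ : (1 : Π i, L i) ∈ Λ)
    (hgen : ∀ p : ℕ, p.Prime →
      (¬ ∃ s : ℤ, ¬ (p : ℤ) ∣ s ∧ (∀ x ∈ M, s • x ∈ Λ) ∧ (∀ x ∈ Λ, s • x ∈ M)) →
        ∃ c : (Π i, L i)ˣ, (c : Π i, L i) ∈ M ∧ ∃ s : ℤ, ¬ (p : ℤ) ∣ s ∧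
          (∀ x ∈ M * Λ, s • x ∈ c • Λ) ∧ (∀ x ∈ c • Λ, s • x ∈ M * Λ)) :
    ∃ L₂ : Submodule ℤ (Π i, L i), IsFullLattice (Π i, L i) L₂ ∧ (1 : Π i, L i) ∈ (M / L₂) * (L₂ / M) ∧
      (1 : Π i, L i) ∈ L₂ ∧ L₂ ≤ Λ := by
  classical
  -- `P_0` = the finitely many primes at which `L` and `Λ` disagree
  set P₀ : Finset ℕ := (finite_setOf_prime_not_locEq hM hΛ).toFinset with hP₀
  have hmemP₀ : ∀ p : ℕ, p ∈ P₀ ↔ p.Prime ∧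
      ¬ ∃ s : ℤ, ¬ (p : ℤ) ∣ s ∧ (∀ x ∈ M, s • x ∈ Λ) ∧ (∀ x ∈ Λ, s • x ∈ M) := fun p => by
    rw [hP₀, Set.Finite.mem_toFinset, Set.mem_setOf_eq]
  have hgen' : ∀ p ∈ P₀, ∃ c : (Π i, L i)ˣ, (c : Π i, L i) ∈ M ∧ ∃ s : ℤ, ¬ (p : ℤ) ∣ s ∧
      (∀ x ∈ M * Λ, s • x ∈ c • Λ) ∧ (∀ x ∈ c • Λ, s • x ∈ M * Λ) := fun p hp =>
    hgen p ((hmemP₀ p).1 hp).1 ((hmemP₀ p).1 hp).2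
  choose! c hc using hgen'
  -- local models: `c_p⁻¹L` at `p ∈ P_0`, `Λ` elsewhere; glue them (Thm. 7.2 (c))
  let a : ℕ → (Π i, L i)ˣ := fun p => if p ∈ P₀ then (c p)⁻¹ else 1
  have ha : ∀ p ∉ P₀, a p = 1 := fun p hp => if_neg hp
  have ha' : ∀ p ∈ P₀, a p = (c p)⁻¹ := fun p hp => if_pos hp
  let U : ℕ → Submodule ℤ (Π i, L i) := fun p => if p ∈ P₀ then a p • M else Λ
  have hUin : ∀ p ∈ P₀, U p = a p • M := fun p hp => if_pos hp
  have hUout : ∀ p ∉ P₀, U p = Λ := fun p hp => if_neg hp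
  have hU : ∀ p, IsFullLattice (Π i, L i) (U p) := fun p => by
    by_cases hp : p ∈ P₀
    · rw [hUin p hp]; exact isFullLattice_units_smul _ hM
    · rw [hUout p hp]; exact hΛ
  obtain ⟨L₂, hL₂, hloc⟩ := exists_isFullLattice_forall_prime_locEq hΛ hU P₀ hUout
  refine ⟨L₂, hL₂, ?_, ?_, fun x hx => ?_⟩
  · -- `L_2 ∼_w L` (Rem. 7.4): `L_2` agrees with `a_pL` at every prime
    refine one_mem_div_mul_div_of_forall_prime_locEq_units_smul hM hL₂ a P₀ ha fun p hp => ?_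
    by_cases hp0 : p ∈ P₀
    · rw [← hUin p hp0]; exact hloc p hp
    · rw [ha p hp0, one_smul]
      have h1 := hloc p hp
      rw [hUout p hp0] at h1
      have h2 : ∃ s : ℤ, ¬ (p : ℤ) ∣ s ∧ (∀ x ∈ M, s • x ∈ Λ) ∧ (∀ x ∈ Λ, s • x ∈ M) := by
        by_contra hne
        exact hp0 ((hmemP₀ p).2 ⟨hp, hne⟩)
      exact locEq_trans hp h1 (locEq_symm h2)
  · -- `1 ∈ L_2`: `1 = c_p⁻¹c_p ∈ c_p⁻¹L` at `p ∈ P_0`, `1 ∈ Λ` elsewhere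
    refine mem_of_forall_prime_exists_not_dvd_smul_mem fun p hp => ?_
    obtain ⟨s, hs, -, hUL⟩ := hloc p hp
    refine ⟨s, hs, hUL 1 ?_⟩
    by_cases hp0 : p ∈ P₀
    · rw [hUin p hp0, ha' p hp0, mem_units_smul_submodule_iff, inv_inv, Units.smul_def, smul_eq_mul, mul_one]
      exact (hc p hp0).1
    · rw [hUout p hp0]; exact h1Λ
  · -- `L_2 ⊆ Λ`: at `p ∈ P_0`, `c_p⁻¹L ⊆ c_p⁻¹(LΛ)`, which agrees with `c_p⁻¹c_pΛ = Λ`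
    refine mem_of_forall_prime_exists_not_dvd_smul_mem fun q hq => ?_
    obtain ⟨s, hs, hLU, -⟩ := hloc q hq
    have hsx := hLU x hx
    by_cases hq0 : q ∈ P₀
    · rw [hUin q hq0, ha' q hq0, mem_units_smul_submodule_iff, inv_inv] at hsx
      obtain ⟨s', hs', hMΛc, -⟩ := (hc q hq0).2
      have h3 := hMΛc _ (Submodule.mul_mem_mul hsx h1Λ)
      rw [mem_units_smul_submodule_iff, units_inv_smul_zsmul_eq] at h3
      exact ⟨s' * s, fun h => ((Nat.prime_iff_prime_int.1 hq).dvd_or_dvd h).elim hs' hs, h3⟩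
    · rw [hUout q hq0] at hsx
      exact ⟨s, hs, hsx⟩

/-! ## §5 Thm. 10.1 (DTZ62 Theorem C): `L^k` is invertible for `k ≥ n − 1` -/

/-- **HL 2026, PROOF OF THM. 10.1 (from (b) on): if the weak class of `L` contains a lattice `L_2` with `1 ∈ L_2 ⊆ Λ′` for
an order `Λ′`, then every power `L^k`, `k ≥ n − 1` (`n = dim_ℚ Y ≥ 2`), is INVERTIBLE, with order `𝒪(L^k) = L_2^{n−1}`
independent of `k`** («By (5.3) and Theorem 5.7 (b) `Λ_2 ⊃ 𝒪(L_2) = 𝒪(L)`. Then by (4.4) `L^{n−1+l} ∼_w L_2^{n−1+l} = Λ_2`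
for `l ≥ 0`, so by Theorem 4.4 (c) and Theorem 5.7 (b) `L^{n−1+l}` is invertible for `l ≥ 0` with
`𝒪(L^{n−1+l}) = Λ_2`»). [cite: HertlingLarabi2026, §10 proof of Thm. 10.1, chunk p0028] [cite: DadeTausskyZassenhaus1962, §1.5 Theorem C] -/
theorem pow_mul_div_div_eq_of_weak_one_mem_le_order {M L₂ Λ : Submodule ℤ (Π i, L i)}
    (hL₂ : IsFullLattice (Π i, L i) L₂)
    (hw : (1 : Π i, L i) ∈ (M / L₂) * (L₂ / M)) (h1 : (1 : Π i, L i) ∈ L₂) (hΛ : IsFullLattice (Π i, L i) Λ)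
    (h1Λ : (1 : Π i, L i) ∈ Λ) (hΛΛ : Λ * Λ ≤ Λ) (hL₂Λ : L₂ ≤ Λ) (hn : 2 ≤ finrank ℚ (Π i, L i)) {k : ℕ}
    (hk : finrank ℚ (Π i, L i) - 1 ≤ k) :
    M ^ k * ((M ^ k / M ^ k) / M ^ k) = M ^ k / M ^ k ∧ M ^ k / M ^ k = L₂ ^ (finrank ℚ (Π i, L i) - 1) := by
  -- `L^j ∼_w L_2^j` for every `j` ((4.4))
  have hwk : ∀ j : ℕ, (1 : Π i, L i) ∈ (M ^ j / L₂ ^ j) * (L₂ ^ j / M ^ j) := fun j => by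
    induction j with
    | zero => rw [pow_zero, pow_zero]; exact one_mem_div_self_mul_div_self 1
    | succ j ih => rw [pow_succ, pow_succ]; exact one_mem_div_mul_div_mul ih hw
  obtain ⟨h1k, hkk, -, -, -, -⟩ := pow_isOrder_of_one_mem_le_order hL₂ h1 hΛ h1Λ hΛΛ hL₂Λ hn hk
  obtain ⟨hO, hinv⟩ := (one_mem_div_mul_div_order_iff h1k hkk.le).1 (hwk k)
  exact ⟨hinv, hO.trans (pow_eq_pow_finrank_sub_one_of_one_mem_le_order hL₂ h1 hΛ h1Λ hΛΛ hL₂Λ hn hk)⟩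

/-- **HL 2026 THM. 10.1 ∕ DTZ62 THEOREM C ∕ Si70 FOR LATTICES WITH LOCAL GENERATORS: let `L` be a full lattice in
`Y = L_1 ⊕ ⋯ ⊕ L_t`, `n = dim_ℚ Y ≥ 2`, and `Λ` ANY order such that at every prime `p` where `L` and `Λ` disagree some
`c_p ∈ L ∩ Y^×` generates `LΛ` locally (`(LΛ)_(p) = c_pΛ_(p)`).  Then `L^k` is INVERTIBLE for every `k ≥ n − 1`** («For
each full lattice `L ∈ 𝓛(A)` each power `L^k` with `k ≥ n − 1` is invertible» — here through §4's (b)-substitute; the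
hypothesis holds, e.g., when each bad `p` has at most `p` maximal ideals of `Λ` above it, and is void of content for
`1 ∈ uL ⊆ Λ`). [cite: HertlingLarabi2026, §10 Thm. 10.1, chunk p0026] [cite: DadeTausskyZassenhaus1962, §1.5 Theorem C] -/
theorem pow_mul_div_div_eq_of_forall_exists_units_locEq {M Λ : Submodule ℤ (Π i, L i)}
    (hM : IsFullLattice (Π i, L i) M) (hΛ : IsFullLattice (Π i, L i) Λ) (h1Λ : (1 : Π i, L i) ∈ Λ)
    (hΛΛ : Λ * Λ ≤ Λ)
    (hgen : ∀ p : ℕ, p.Prime →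
      (¬ ∃ s : ℤ, ¬ (p : ℤ) ∣ s ∧ (∀ x ∈ M, s • x ∈ Λ) ∧ (∀ x ∈ Λ, s • x ∈ M)) →
        ∃ c : (Π i, L i)ˣ, (c : Π i, L i) ∈ M ∧ ∃ s : ℤ, ¬ (p : ℤ) ∣ s ∧
          (∀ x ∈ M * Λ, s • x ∈ c • Λ) ∧ (∀ x ∈ c • Λ, s • x ∈ M * Λ))
    (hn : 2 ≤ finrank ℚ (Π i, L i)) :
    ∃ Λ₂ : Submodule ℤ (Π i, L i), (1 : Π i, L i) ∈ Λ₂ ∧ Λ₂ * Λ₂ = Λ₂ ∧ Λ₂ ≤ Λ ∧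
      ∀ k : ℕ, finrank ℚ (Π i, L i) - 1 ≤ k →
        M ^ k * ((M ^ k / M ^ k) / M ^ k) = M ^ k / M ^ k ∧ M ^ k / M ^ k = Λ₂ := by
  obtain ⟨L₂, hL₂, hw, h1, hle⟩ := exists_weak_one_mem_le_order_of_forall_exists_units_locEq hM hΛ h1Λ hgen
  obtain ⟨h1k, hkk, -, -, -, -⟩ := pow_isOrder_of_one_mem_le_order hL₂ h1 hΛ h1Λ hΛΛ hle hn le_rfl
  exact ⟨L₂ ^ (finrank ℚ (Π i, L i) - 1), h1k, hkk, pow_le_of_le_order h1Λ hΛΛ hle _, fun k hk =>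
    pow_mul_div_div_eq_of_weak_one_mem_le_order hL₂ hw h1 hΛ h1Λ hΛΛ hle hn hk⟩

/-- **THM. 10.1, THE CASE `1 ∈ uL ⊆ Λ` (no local hypothesis): if some unit multiple `uL` contains `1` and lies in an
order, then `L^k` is invertible for all `k ≥ n − 1`, with `𝒪(L^k) = (uL)^{n−1}`** (`L ∼_ε uL ⟹ L ∼_w uL`, g32-#1
`one_mem_div_mul_div_of_units_smul_eq`; then §5's first theorem). [cite: HertlingLarabi2026, §10 Thm. 10.1 with Thm. 10.3 (c)(d), chunks p0026, p0028] [cite: DadeTausskyZassenhaus1962, §1.5 Theorem C] -/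
theorem pow_mul_div_div_eq_of_one_mem_units_smul_le_order {M Λ : Submodule ℤ (Π i, L i)} {u : (Π i, L i)ˣ}
    (hM : IsFullLattice (Π i, L i) M) (h1 : (1 : Π i, L i) ∈ u • M) (hΛ : IsFullLattice (Π i, L i) Λ)
    (h1Λ : (1 : Π i, L i) ∈ Λ) (hΛΛ : Λ * Λ ≤ Λ) (hle : u • M ≤ Λ) (hn : 2 ≤ finrank ℚ (Π i, L i)) {k : ℕ}
    (hk : finrank ℚ (Π i, L i) - 1 ≤ k) :
    M ^ k * ((M ^ k / M ^ k) / M ^ k) = M ^ k / M ^ k ∧ M ^ k / M ^ k = (u • M) ^ (finrank ℚ (Π i, L i) - 1) :=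
  pow_mul_div_div_eq_of_weak_one_mem_le_order (isFullLattice_units_smul u hM)
    (one_mem_div_mul_div_of_units_smul_eq rfl) h1 hΛ h1Λ hΛΛ hle hn hk

end PowersInvertible

end Literature.NumberTheory.ComplexMultiplication
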